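import Summits.QuantumFields.BalabanUV.Beta.EriceRemainderEnclosureHistoryAutonomyComparisonAgeCompositionAgeRatioWindowClusters
import Summits.QuantumFields.BalabanUV.Beta.EriceRemainderEnclosureHistoryAutonomyComparisonAgeCompositionOldBlockLevelsThree

/-!
# EriceRemainderEnclosureHistoryAutonomyComparisonAgeCompositionWindowBlockLevels — (E112d) route (N), first order: DENSE BLOCKS OF ANY AGE AS CASCADE LEVELS.
# The rate-three cascade (E110k) `flow_nonneg_cluster_levels_of_caps_three` settles every profile that is a disjoint union of clusters `S_0, S_1, …` with
# DISPLAYED caps (`Σ_{S_0} x ≤ s₀`, `Σ_{S_j} x ≤ s` at every pin), separations `lo_{j+1} ≥ R₀·hi_j` and the closure `κ + 3s(1+κ) ≤ R₀(1−s(1+κ))κ`; so far the caps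
# came from pair letters ((E100b): OLD octaves `a_j ≥ 56`, cap `5∕8`) or single∕pair loads.  (E112b) `cluster_load_le_log` caps EVERY cluster of ages inside
# `[lo, F·lo]` — any `lo ≥ 1`, any number of ages — by `(√2∕2)(1 + ⅛·log((1+F)∕2))`: `0.7431` for octaves (`F = 2`, `window_const_three_halves`), `0.7684` for
# span three.  Hence **`flow_nonneg_octave_block_levels`**: EVERY profile that is a disjoint union of OCTAVE CLUSTERS `S_j ⊂ [lo_j, 2lo_j]` (ANY `lo_0 ≥ 1` — the
# youngest block may be `{1,2}`, `{3,…,6}`, … — any ages inside each) separated by `lo_{j+1} ≥ 128·hi_j` (`κ = 0.16`: `0.16 + 3·0.7431·1.16 ≤ 128·(1 −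
# 0.7431·1.16)·0.16`), and **`flow_nonneg_span_three_block_levels`**: blocks `S_j ⊂ [lo_j, 3lo_j]` separated by `×160` (`κ = 0.14`, `s = 0.7684`) — every horizon,
# every damping of the self-consistent class, NO hypothesis left on the loads and NO age floor on the blocks.

Cell `pub-balaban`, β-function sub-cell, BINDER row D4 «RemainderConst leaves for Bałaban's split» (`HOME/BINDER-OWNERS.md`; owner lineage `b2b-balaban-beta-an4`;
this file by co-owner #2 lineage `b2b-balaban-beta-d4-p2`, generation 93), β-FLOW TEAM duty (1), FREEZE (0) honoured (def-free; imports (E112b) and (E110k); uses (E110k)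
`flow_nonneg_cluster_levels_of_caps_three`, (E112b) `cluster_load_le_log` ∕ `window_const_two` ∕ `sqrt_two_div_two_le` ∕ `log_three_le` BY NAME; nothing restated).

HONEST FRAMING (page 1, verbatim and binding).  *"Discharging BetaPertH makes Bałaban's UV stability UNCONDITIONAL — a real constructive-QFT result; it is
NOT the continuum limit and NOT the Clay problem."*  THIS FILE DISCHARGES NOTHING OF THE KIND.  Elementary real analysis about ABSTRACT functionals on a box
]0,γ]^ℕ with displayed floors, profiles and signs, and the FIRST-ORDER renewal objects of route (N) built from them — hypotheses of a census, not facts; the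
form, signs, ages and moments of Bałaban's (1.22) limit functional are NOT PRINTED ([I] p. 298; GAPS G-t4-U2-1∕-2) and NOT asserted.  Row D4 class
UNCHANGED (critical-path width 0; instance 0∕1; D4 DISCHARGE NO DATE).  HONEST DEPENDENCY: continuum YM on T⁴ ⇐ BetaPertH ∧ nine spine estimates (0/9
proved); BetaPertH ⇐ (D1) ∧ (D4) ∧ CAP+tail; G-an2-4 gates asym, D1 and NE2/3/4.

THE POINT (README `HOME/b2b-balaban-beta-d4-p2/g93/README.md` §4).  NOT CLAIMED: separations below `×128` ∕ `×160` (the old-octave cascade of (E110k) reaches `×49`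
with the sharper cap `5∕8`, but only for blocks older than `56`); anything printed — NOT B12 Thm 2, NOT BetaPertH, NOT continuum, NOT Clay.

WHAT IS PROVED ([folklore]; 0 `def`, 0 sorry).  §1 `window_const_three_halves`, **`block_load_le_of_span`**.  §2 **`flow_nonneg_window_block_levels`** (any span
factor `F` with a cap `s` and a closure), **`flow_nonneg_octave_block_levels`**, **`flow_nonneg_span_three_block_levels`**.
-/
noncomputable section
open Finset

namespace Summit.QuantumFields.BalabanUV.Beta.EriceRemainderEnclosureHistoryAutonomyComparisonAgeCompositionWindowBlockLevels

open Literature.MathematicalPhysics.QuantumFieldTheory.Balaban1983to89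
open Literature.MathematicalPhysics.QuantumFieldTheory.Balaban1983to89.T4BetaStationary
open Literature.MathematicalPhysics.QuantumFieldTheory.Balaban1983to89.T4BetaFlowWellPosed
open Summit.QuantumFields.BalabanUV.Beta.EriceRemainderEnclosureHistoryAutonomyComparisonAgeCompositionOldBlockLevelsThree (flow_nonneg_cluster_levels_of_caps_three)
open Summit.QuantumFields.BalabanUV.Beta.EriceRemainderEnclosureHistoryAutonomyComparisonAgeCompositionAgeRatioWindowClusters
  (cluster_load_le_log window_const_two sqrt_two_div_two_le log_three_le)

variable {B : (ℕ → ℝ) → ℝ} {γ b gIR : ℝ} {L : ℕ → ℝ} {K : ℕ} {h g : ℕ → ℝ}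

/-! ## §1 The cap of a block of span factor `F` -/

/-- Octaves: `0 < x ≤ 3∕2 ⟹ (√2∕2)(1 + ⅛·log x) ≤ 0.7431` (`log(3∕2) = log 3 − log 2 ≤ 1.1 − 0.6931471803`). [folklore] -/
theorem window_const_three_halves {x : ℝ} (hx0 : 0 < x) (hx : x ≤ 3 / 2) : Real.sqrt 2 / 2 * (1 + Real.log x / 8) ≤ 0.7431 := by
  have hl : Real.log x ≤ Real.log (3 / 2) := Real.log_le_log hx0 hx
  have h32 : Real.log (3 / 2) = Real.log 3 - Real.log 2 := Real.log_div (by norm_num) (by norm_num)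
  have h2 := Real.log_two_gt_d9
  have h3 := log_three_le
  have hs := sqrt_two_div_two_le
  have hs0 : 0 ≤ Real.sqrt 2 / 2 := by positivity
  have hlx : Real.log x ≤ 11 / 10 - 0.6931471803 := by linarith
  calc Real.sqrt 2 / 2 * (1 + Real.log x / 8) ≤ Real.sqrt 2 / 2 * (1 + (11 / 10 - 0.6931471803) / 8) := by
        apply mul_le_mul_of_nonneg_left _ hs0; linarith
    _ ≤ 0.7071068 * (1 + (11 / 10 - 0.6931471803) / 8) := mul_le_mul_of_nonneg_right hs (by norm_num)
    _ ≤ 0.7431 := by norm_num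

/-- **THE LOAD OF A BLOCK OF SPAN FACTOR `F` INSIDE ANY PROFILE.**  `L ≥ 0` on the ages `< K` dominated by the isotone memory with floor; a finite set `S` of ages
inside `[lo, hi]` with `1 ≤ lo ≤ hi ≤ F·lo`, `hi < K`; IF `(√2∕2)(1 + ⅛·log x) ≤ s` for all `0 < x ≤ (1+F)∕2` THEN `Σ_{k∈S} k·L_kh(q+k)³∕2 ≤ s` at every pin
((E112b) `cluster_load_le_log` on `[lo, hi+1)`: `(lo+hi)∕(2lo) ≤ (1+F)∕2`). [folklore] -/
theorem block_load_le_of_span (hmono : ∀ u v : ℕ → ℝ, SeqBox γ u → SeqBox γ v → (∀ j, u j ≤ v j) → B u ≤ B v)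
    (hL : ∀ k, 0 ≤ L k) (hb : 0 < b) (hlo : ∀ u, SeqBox γ u → b ≤ B u) (hdom : ∀ u, SeqBox γ u → ∑ k ∈ range K, L k * u k ≤ B u)
    (hh : SeqBox γ h) (hf : MemFlow B gIR h) {F : ℕ} {s : ℝ} (hs : ∀ x : ℝ, 0 < x → x ≤ (1 + (F : ℝ)) / 2 → Real.sqrt 2 / 2 * (1 + Real.log x / 8) ≤ s)
    {S : Finset ℕ} {lo hi : ℕ} (hlo1 : 1 ≤ lo) (hlohi : lo ≤ hi) (hhiF : hi ≤ F * lo) (hhiK : hi < K) (hS : ∀ k ∈ S, lo ≤ k ∧ k ≤ hi) (q : ℕ) :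
    ∑ k ∈ S, (k : ℝ) * (L k * h (q + k) ^ 3 / 2) ≤ s := by
  have hpos : ∀ n, 0 < h n := fun n => (hh n).1
  have hlor : (1 : ℝ) ≤ lo := by exact_mod_cast hlo1
  have hhir : ((hi : ℕ) : ℝ) ≤ ((F * lo : ℕ) : ℝ) := by exact_mod_cast hhiF
  have hlh : ((lo : ℕ) : ℝ) ≤ ((hi : ℕ) : ℝ) := by exact_mod_cast hlohi
  push_cast at hhir hlh
  have hsub : S ⊆ Ico lo (hi + 1) := fun k hk => mem_Ico.mpr ⟨(hS k hk).1, Nat.lt_succ_of_le (hS k hk).2⟩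
  have h1 : ∑ k ∈ S, (k : ℝ) * (L k * h (q + k) ^ 3 / 2) ≤ ∑ k ∈ Ico lo (hi + 1), (k : ℝ) * (L k * h (q + k) ^ 3 / 2) :=
    sum_le_sum_of_subset_of_nonneg hsub fun k _ _ => by have := hL k; have := hpos (q + k); positivity
  have h2 := cluster_load_le_log hmono hL hb hlo hdom hh hf hlo1 (show lo + 1 ≤ hi + 1 by omega) (show hi + 1 ≤ K by omega) q
  have hx0 : (0 : ℝ) < ((lo : ℝ) + ((hi + 1 : ℕ) : ℝ) - 1) / (2 * (lo : ℝ)) := by push_cast; apply div_pos <;> linarith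
  have hxF : ((lo : ℝ) + ((hi + 1 : ℕ) : ℝ) - 1) / (2 * (lo : ℝ)) ≤ (1 + (F : ℝ)) / 2 := by
    push_cast; rw [div_le_div_iff₀ (by positivity) (by norm_num)]; nlinarith
  have h3 := hs _ hx0 hxF
  rw [Real.log_div (by push_cast; linarith) (by positivity)] at h3
  exact h1.trans (h2.trans h3)

/-! ## §2 Blocks of bounded span as the levels of the rate-three cascade -/

/-- **BLOCKS OF SPAN FACTOR `F` AS CASCADE LEVELS.**  Profile = disjoint union of `r ≥ 1` clusters `S_j ⊂ [lo_j, hi_j]`, `1 ≤ lo_j ≤ hi_j ≤ F·lo_j`, `hi_j < K`,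
`lo_{j+1} ≥ R₀·hi_j`, `L_l = 0` off the clusters; the memory isotone with floor dominating `L ≥ 0`, `h` a box solution, dampings of the self-consistent class; a cap
`s` of the span factor (`(√2∕2)(1 + ⅛·log x) ≤ s` on `]0, (1+F)∕2]`) and `κ > 0` with `s(1+κ) < 1` and the closure `κ + 3s(1+κ) ≤ R₀(1−s(1+κ))κ`.  THEN `0 ≤ ε ≤ e`
for every admissible excess, every horizon ((E110k) `flow_nonneg_cluster_levels_of_caps_three` with every cap discharged by `block_load_le_of_span`). [folklore] -/
theorem flow_nonneg_window_block_levels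
    (hmono : ∀ u v : ℕ → ℝ, SeqBox γ u → SeqBox γ v → (∀ j, u j ≤ v j) → B u ≤ B v)
    (hL : ∀ k, 0 ≤ L k) (hb : 0 < b) (hlo : ∀ u, SeqBox γ u → b ≤ B u) (hdom : ∀ u, SeqBox γ u → ∑ k ∈ range K, L k * u k ≤ B u)
    (hh : SeqBox γ h) (hf : MemFlow B gIR h) (hg : ∀ t, 0 < g t ∧ g t ≤ 1)
    (hgF : ∀ t, 1 ≤ g t * (1 + ∑ k ∈ range K, L k * h (t + k) ^ 3 / 2)) (hK : 1 ≤ K)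
    {F R₀ : ℕ} {s κ : ℝ} (hs : ∀ x : ℝ, 0 < x → x ≤ (1 + (F : ℝ)) / 2 → Real.sqrt 2 / 2 * (1 + Real.log x / 8) ≤ s)
    (hκ : 0 < κ) (hsC : s * (1 + κ) < 1) (hR : κ + 3 * s * (1 + κ) ≤ (R₀ : ℝ) * (1 - s * (1 + κ)) * κ)
    {r : ℕ} {S : ℕ → Finset ℕ} {lo hi : ℕ → ℕ} (hr : 1 ≤ r)
    (hlo1 : ∀ j, j < r → 1 ≤ lo j) (hlohi : ∀ j, j < r → lo j ≤ hi j) (hhiF : ∀ j, j < r → hi j ≤ F * lo j) (hhiK : ∀ j, j < r → hi j < K)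
    (hS : ∀ j, j < r → ∀ k ∈ S j, lo j ≤ k ∧ k ≤ hi j)
    (hsep : ∀ j, j + 1 < r → R₀ * hi j ≤ lo (j + 1)) (hdisj : ∀ i j, i < j → j < r → Disjoint (S i) (S j))
    (hLS : ∀ l, l < K → (∀ j, j < r → l ∉ S j) → L l = 0)
    {N : ℕ} {KL : ℕ → ℕ → ℕ → ℝ}
    (hKL : ∀ k n l, KL k n l = if 0 < k ∧ k < K ∧ l < k then L k * h (n + k) ^ 3 / 2 * ∏ t ∈ Ico (n + 1 + l) (n + k + 1), g t else 0)
    {KA : ℕ → ℕ → ℕ → ℝ} {RA : ℕ → (ℕ → ℝ) → ℕ → ℝ}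
    (hRA : ∀ i v m, RA i v m = ∑ l ∈ range K, KA i m l * v (m + 1 + l))
    (hKA : ∀ i m l, KA i m l = KL i m l + KA (i + 1) m l) (hKAtop : ∀ m l, KA K m l = 0)
    {e ε : ℕ → ℝ} (he0 : ∀ m, 0 ≤ e m) (hea : ∀ m, e (m + 1) ≤ e m)
    (hεt : ∀ m, N < m → ε m = 0) (hεrec : ∀ m, ε m = e m - RA 1 ε m) : ∀ m, 0 ≤ ε m ∧ ε m ≤ e m := by
  have hcap : ∀ j q, j < r → ∑ k ∈ S j, (k : ℝ) * (L k * h (q + k) ^ 3 / 2) ≤ s := fun j q hj =>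
    block_load_le_of_span hmono hL hb hlo hdom hh hf hs (hlo1 j hj) (hlohi j hj) (hhiF j hj) (hhiK j hj) (hS j hj) q
  have hs0 : 0 ≤ s := by
    have h0 := hcap 0 0 (by omega)
    exact le_trans (sum_nonneg fun k _ => by have := hL k; have := (hh (0 + k)).1; positivity) h0
  exact flow_nonneg_cluster_levels_of_caps_three hmono hL hb hlo hdom hh hf hg hgF hK (s₀ := s) hκ hs0 hsC.le hsC hR
    (fun j hj k hk => ⟨le_trans (hlo1 j hj) (hS j hj k hk).1, lt_of_le_of_lt (hS j hj k hk).2 (hhiK j hj)⟩)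
    (fun j hj k hk => (hS j hj k hk).1) (fun j hj k hk => (hS j hj k hk).2) (fun j _ hj => hlohi j hj) (fun j _ hj => hlo1 j hj)
    hsep hdisj hLS (fun q => hcap 0 q (by omega)) (fun j q _ hj => hcap j q hj) hKL hRA hKA hKAtop he0 hea hεt hεrec

/-- **OCTAVE BLOCKS OF ANY AGE, SEPARATED BY `×128`.**  Profile = disjoint union of clusters `S_j ⊂ [lo_j, 2lo_j]` (`lo_j ≥ 1`, any ages inside, `hi_j < K`)
with `lo_{j+1} ≥ 128·hi_j`; dampings of the self-consistent class.  THEN `0 ≤ ε ≤ e` (`s = 0.7431`, `κ = 0.16`, `R₀ = 128`). [folklore] -/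
theorem flow_nonneg_octave_block_levels
    (hmono : ∀ u v : ℕ → ℝ, SeqBox γ u → SeqBox γ v → (∀ j, u j ≤ v j) → B u ≤ B v)
    (hL : ∀ k, 0 ≤ L k) (hb : 0 < b) (hlo : ∀ u, SeqBox γ u → b ≤ B u) (hdom : ∀ u, SeqBox γ u → ∑ k ∈ range K, L k * u k ≤ B u)
    (hh : SeqBox γ h) (hf : MemFlow B gIR h) (hg : ∀ t, 0 < g t ∧ g t ≤ 1)
    (hgF : ∀ t, 1 ≤ g t * (1 + ∑ k ∈ range K, L k * h (t + k) ^ 3 / 2)) (hK : 1 ≤ K)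
    {r : ℕ} {S : ℕ → Finset ℕ} {lo hi : ℕ → ℕ} (hr : 1 ≤ r)
    (hlo1 : ∀ j, j < r → 1 ≤ lo j) (hlohi : ∀ j, j < r → lo j ≤ hi j) (hhiF : ∀ j, j < r → hi j ≤ 2 * lo j) (hhiK : ∀ j, j < r → hi j < K)
    (hS : ∀ j, j < r → ∀ k ∈ S j, lo j ≤ k ∧ k ≤ hi j)
    (hsep : ∀ j, j + 1 < r → 128 * hi j ≤ lo (j + 1)) (hdisj : ∀ i j, i < j → j < r → Disjoint (S i) (S j))
    (hLS : ∀ l, l < K → (∀ j, j < r → l ∉ S j) → L l = 0)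
    {N : ℕ} {KL : ℕ → ℕ → ℕ → ℝ}
    (hKL : ∀ k n l, KL k n l = if 0 < k ∧ k < K ∧ l < k then L k * h (n + k) ^ 3 / 2 * ∏ t ∈ Ico (n + 1 + l) (n + k + 1), g t else 0)
    {KA : ℕ → ℕ → ℕ → ℝ} {RA : ℕ → (ℕ → ℝ) → ℕ → ℝ}
    (hRA : ∀ i v m, RA i v m = ∑ l ∈ range K, KA i m l * v (m + 1 + l))
    (hKA : ∀ i m l, KA i m l = KL i m l + KA (i + 1) m l) (hKAtop : ∀ m l, KA K m l = 0)
    {e ε : ℕ → ℝ} (he0 : ∀ m, 0 ≤ e m) (hea : ∀ m, e (m + 1) ≤ e m)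
    (hεt : ∀ m, N < m → ε m = 0) (hεrec : ∀ m, ε m = e m - RA 1 ε m) : ∀ m, 0 ≤ ε m ∧ ε m ≤ e m :=
  flow_nonneg_window_block_levels hmono hL hb hlo hdom hh hf hg hgF hK (F := 2) (R₀ := 128) (s := 0.7431) (κ := 0.16)
    (fun x hx0 hx => window_const_three_halves hx0 (by push_cast at hx; linarith)) (by norm_num) (by norm_num) (by norm_num)
    hr hlo1 hlohi hhiF hhiK hS hsep hdisj hLS hKL hRA hKA hKAtop he0 hea hεt hεrec

/-- **SPAN-THREE BLOCKS OF ANY AGE, SEPARATED BY `×160`.**  Profile = disjoint union of clusters `S_j ⊂ [lo_j, 3lo_j]` (`lo_j ≥ 1`, any ages inside, `hi_j < K`)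
with `lo_{j+1} ≥ 160·hi_j`; dampings of the self-consistent class.  THEN `0 ≤ ε ≤ e` (`s = 0.7684`, `κ = 0.14`, `R₀ = 160`). [folklore] -/
theorem flow_nonneg_span_three_block_levels
    (hmono : ∀ u v : ℕ → ℝ, SeqBox γ u → SeqBox γ v → (∀ j, u j ≤ v j) → B u ≤ B v)
    (hL : ∀ k, 0 ≤ L k) (hb : 0 < b) (hlo : ∀ u, SeqBox γ u → b ≤ B u) (hdom : ∀ u, SeqBox γ u → ∑ k ∈ range K, L k * u k ≤ B u)
    (hh : SeqBox γ h) (hf : MemFlow B gIR h) (hg : ∀ t, 0 < g t ∧ g t ≤ 1)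
    (hgF : ∀ t, 1 ≤ g t * (1 + ∑ k ∈ range K, L k * h (t + k) ^ 3 / 2)) (hK : 1 ≤ K)
    {r : ℕ} {S : ℕ → Finset ℕ} {lo hi : ℕ → ℕ} (hr : 1 ≤ r)
    (hlo1 : ∀ j, j < r → 1 ≤ lo j) (hlohi : ∀ j, j < r → lo j ≤ hi j) (hhiF : ∀ j, j < r → hi j ≤ 3 * lo j) (hhiK : ∀ j, j < r → hi j < K)
    (hS : ∀ j, j < r → ∀ k ∈ S j, lo j ≤ k ∧ k ≤ hi j)
    (hsep : ∀ j, j + 1 < r → 160 * hi j ≤ lo (j + 1)) (hdisj : ∀ i j, i < j → j < r → Disjoint (S i) (S j))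
    (hLS : ∀ l, l < K → (∀ j, j < r → l ∉ S j) → L l = 0)
    {N : ℕ} {KL : ℕ → ℕ → ℕ → ℝ}
    (hKL : ∀ k n l, KL k n l = if 0 < k ∧ k < K ∧ l < k then L k * h (n + k) ^ 3 / 2 * ∏ t ∈ Ico (n + 1 + l) (n + k + 1), g t else 0)
    {KA : ℕ → ℕ → ℕ → ℝ} {RA : ℕ → (ℕ → ℝ) → ℕ → ℝ}
    (hRA : ∀ i v m, RA i v m = ∑ l ∈ range K, KA i m l * v (m + 1 + l))
    (hKA : ∀ i m l, KA i m l = KL i m l + KA (i + 1) m l) (hKAtop : ∀ m l, KA K m l = 0)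
    {e ε : ℕ → ℝ} (he0 : ∀ m, 0 ≤ e m) (hea : ∀ m, e (m + 1) ≤ e m)
    (hεt : ∀ m, N < m → ε m = 0) (hεrec : ∀ m, ε m = e m - RA 1 ε m) : ∀ m, 0 ≤ ε m ∧ ε m ≤ e m :=
  flow_nonneg_window_block_levels hmono hL hb hlo hdom hh hf hg hgF hK (F := 3) (R₀ := 160) (s := 0.7684) (κ := 0.14)
    (fun x hx0 hx => window_const_two hx0 (by push_cast at hx; linarith)) (by norm_num) (by norm_num) (by norm_num)
    hr hlo1 hlohi hhiF hhiK hS hsep hdisj hLS hKL hRA hKA hKAtop he0 hea hεt hεrec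

end Summit.QuantumFields.BalabanUV.Beta.EriceRemainderEnclosureHistoryAutonomyComparisonAgeCompositionWindowBlockLevels

end
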